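import Summits.CriticalPhenomena.PercolationContinuityZ3.Theorems.PercNearOneGluingNoHeavyPcintWindowAut
import HarnessLib

/-!
# PCINT lane, kind `chordrand_cw`: the booking inequality (on-path charges of a causal window automaton)

Cell `prim-pcint`, seat `prim-pcint-2`; memo `run/shared/lean/prim/pcint/REDUCTIONS.md` §B3r.1 (R), §B3r.2 (β'),
§B3r.6 (last paragraph).  Does NOT build on p205010.

A window automaton of memory `m + 2` reading a self-avoiding word `γ` (length `N = m + 1 + k`) cannot tell
whether a lattice neighbour `w` of the new vertex `v_T` (`T = t + m + 2`) that is not a WINDOW site is off the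
whole path; if `w = v_h` is a path vertex outside the window (`h < t` or `h > T`) and has an incidence
`v_i ~ w`, `t ≤ i ≤ T - 2`, the automaton charges it ("on-path event" `(t, h)`).  We book these events
against the chords of `γ`: an event with `h > T` to the chord `{v_x, v_h}` where `x` is the incidence of
`v_h` immediately PRECEDING `T`; an event with `h < t` to the (invisible) chord `{v_h, v_T}`.  Each VISIBLE
chord (span `≤ m + 2`) receives at most one event, each INVISIBLE chord at most two
(`card_onEvents_le`), which is what the refunds `1/s` per visible chord and the slack `(1-p) ≤ s²` of an
invisible chord pay for.  Also: the visible chords are exactly the window chords (`sum_winChordTrue_eq`).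
-/

noncomputable section

namespace Summit.CriticalPhenomena.PercolationContinuityZ3.Theorems.Pcint

open Finset Literature.Probability.Percolation Literature.Probability.LatticeModels

variable {d m : ℕ}

/-! ### On-path events, visible and invisible chords -/

/-- The on-path charge events `(t, h)` of the memory-`(m+2)` window automaton along a word of length
`m + 1 + k`: `v_h` is a path vertex outside the window `[t, t+m+2]`, adjacent to the new vertex `v_{t+m+2}`,
with an incidence `v_i ~ v_h`, `t ≤ i ≤ t + m`. [folklore] -/
def onEvents (m : ℕ) {k : ℕ} (γ : Fin (m + 1 + k) → Fin d × Bool) : Finset (ℕ × ℕ) :=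
  (range k ×ˢ range (m + 1 + k + 1)).filter fun th =>
    (th.2 < th.1 ∨ th.1 + m + 2 < th.2) ∧ (zdGraph d).Adj (wordPos γ th.2) (wordPos γ (th.1 + m + 2)) ∧
      ∃ i : Fin (th.1 + m + 1), th.1 ≤ (i : ℕ) ∧ (zdGraph d).Adj (wordPos γ i) (wordPos γ th.2)

/-- Membership in `onEvents`. [folklore] -/
theorem mem_onEvents {k : ℕ} {γ : Fin (m + 1 + k) → Fin d × Bool} {th : ℕ × ℕ} :
    th ∈ onEvents m γ ↔ th.1 < k ∧ th.2 ≤ m + 1 + k ∧ (th.2 < th.1 ∨ th.1 + m + 2 < th.2) ∧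
      (zdGraph d).Adj (wordPos γ th.2) (wordPos γ (th.1 + m + 2)) ∧
      ∃ i, th.1 ≤ i ∧ i ≤ th.1 + m ∧ (zdGraph d).Adj (wordPos γ i) (wordPos γ th.2) := by
  rw [onEvents, mem_filter, mem_product, mem_range, mem_range, Nat.lt_succ_iff]
  constructor
  · rintro ⟨⟨h1, h2⟩, h3, h4, i, h5, h6⟩
    exact ⟨h1, h2, h3, h4, i, h5, by have := i.2; omega, h6⟩
  · rintro ⟨h1, h2, h3, h4, i, h5, h6, h7⟩
    exact ⟨⟨h1, h2⟩, h3, h4, ⟨i, by omega⟩, h5, h7⟩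

/-- The VISIBLE chords for memory `m + 2` (span at most `m + 2`, larger endpoint at least `m + 2`). [folklore] -/
def visChords (m : ℕ) {N : ℕ} (γ : Fin N → Fin d × Bool) : Finset (ℕ × ℕ) :=
  (chordPairs γ).filter fun ij => m + 2 ≤ ij.2 ∧ ij.2 ≤ ij.1 + (m + 2)

/-- The INVISIBLE chords for memory `m + 2` (span more than `m + 2`). [folklore] -/
def invChords (m : ℕ) {N : ℕ} (γ : Fin N → Fin d × Bool) : Finset (ℕ × ℕ) :=
  (chordPairs γ).filter fun ij => ij.1 + (m + 2) < ij.2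

/-- Visible and invisible chords are disjoint sets of chords. [folklore] -/
theorem card_visChords_add_card_invChords_le {N : ℕ} (γ : Fin N → Fin d × Bool) :
    (visChords m γ).card + (invChords m γ).card ≤ (chordPairs γ).card := by
  rw [← card_union_of_disjoint]
  · exact card_le_card (union_subset (filter_subset _ _) (filter_subset _ _))
  · rw [disjoint_left]
    intro ij h1 h2
    have a := (mem_filter.1 h1).2
    have b := (mem_filter.1 h2).2
    omega

/-! ### The booking map -/

/-- The incidence of `v_h` immediately preceding time `T` among `i < T` with `i + 2 ≤ h` (junk `0`). [folklore] -/
def prevInc {N : ℕ} (γ : Fin N → Fin d × Bool) (T h : ℕ) : ℕ :=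
  if hne : ((range T).filter fun i => i + 2 ≤ h ∧ (zdGraph d).Adj (wordPos γ i) (wordPos γ h)).Nonempty
  then ((range T).filter fun i => i + 2 ≤ h ∧ (zdGraph d).Adj (wordPos γ i) (wordPos γ h)).max' hne else 0

/-- If a candidate exists, `prevInc` is a candidate at least as large. [folklore] -/
theorem prevInc_spec {N : ℕ} (γ : Fin N → Fin d × Bool) {T h i : ℕ} (hi : i < T) (hi2 : i + 2 ≤ h)
    (hadj : (zdGraph d).Adj (wordPos γ i) (wordPos γ h)) :
    i ≤ prevInc γ T h ∧ prevInc γ T h < T ∧ prevInc γ T h + 2 ≤ h ∧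
      (zdGraph d).Adj (wordPos γ (prevInc γ T h)) (wordPos γ h) := by
  have hmem : i ∈ (range T).filter fun i => i + 2 ≤ h ∧ (zdGraph d).Adj (wordPos γ i) (wordPos γ h) :=
    mem_filter.2 ⟨mem_range.2 hi, hi2, hadj⟩
  have hne : ((range T).filter fun i => i + 2 ≤ h ∧ (zdGraph d).Adj (wordPos γ i) (wordPos γ h)).Nonempty :=
    ⟨i, hmem⟩
  rw [prevInc, dif_pos hne]
  have hmax := max'_mem _ hne
  rw [mem_filter, mem_range] at hmax
  exact ⟨le_max' _ _ hmem, hmax.1, hmax.2.1, hmax.2.2⟩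

/-- The booking map: events after the window go to the chord from the preceding incidence, events before the
window go to the long chord to the new vertex. [folklore] -/
def book (m : ℕ) {N : ℕ} (γ : Fin N → Fin d × Bool) (th : ℕ × ℕ) : ℕ × ℕ :=
  if th.2 < th.1 then (th.2, th.1 + m + 2) else (prevInc γ (th.1 + m + 2) th.2, th.2)

/-- The booking map lands in the visible or invisible chords; events before the window land in the invisible
ones. [folklore] -/
theorem book_mem {k : ℕ} {γ : Fin (m + 1 + k) → Fin d × Bool} {th : ℕ × ℕ} (h : th ∈ onEvents m γ) :
    book m γ th ∈ visChords m γ ∪ invChords m γ ∧ (th.2 < th.1 → book m γ th ∈ invChords m γ) := by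
  obtain ⟨htk, hhN, hout, hadjT, i, hti, hiT, hadji⟩ := mem_onEvents.1 h
  by_cases hlt : th.2 < th.1
  · have hmem : book m γ th ∈ invChords m γ := by
      rw [book, if_pos hlt, invChords, mem_filter, mem_chordPairs]
      exact ⟨⟨by simp only; omega, by simp only; omega, hadjT⟩, by simp only; omega⟩
    exact ⟨mem_union_right _ hmem, fun _ => hmem⟩
  · have hgt : th.1 + m + 2 < th.2 := by omega
    obtain ⟨-, hpT, hp2, hpadj⟩ := prevInc_spec γ (T := th.1 + m + 2) (by omega : i < th.1 + m + 2) (by omega) hadji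
    refine ⟨?_, fun h' => (hlt h').elim⟩
    rw [book, if_neg hlt]
    have hcp : (prevInc γ (th.1 + m + 2) th.2, th.2) ∈ chordPairs γ := mem_chordPairs.2 ⟨hp2, hhN, hpadj⟩
    by_cases hvis : th.2 ≤ prevInc γ (th.1 + m + 2) th.2 + (m + 2)
    · exact mem_union_left _ (mem_filter.2 ⟨hcp, by simp only; omega, hvis⟩)
    · exact mem_union_right _ (mem_filter.2 ⟨hcp, by simp only; omega⟩)

/-- Two events AFTER their windows at the same vertex book to different chords. [folklore] -/
theorem book_inj_after {k : ℕ} {γ : Fin (m + 1 + k) → Fin d × Bool} {th th' : ℕ × ℕ}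
    (h : th ∈ onEvents m γ) (h' : th' ∈ onEvents m γ) (ha : ¬ th.2 < th.1) (ha' : ¬ th'.2 < th'.1)
    (heq : book m γ th = book m γ th') : th = th' := by
  obtain ⟨-, -, hout, hadjT, i, hti, hiT, hadji⟩ := mem_onEvents.1 h
  obtain ⟨-, -, hout', hadjT', i', hti', hiT', hadji'⟩ := mem_onEvents.1 h'
  rw [book, if_neg ha, book, if_neg ha'] at heq
  obtain ⟨hp, hh⟩ := Prod.mk.inj heq
  have hgt : th.1 + m + 2 < th.2 := by omega
  have hgt' : th'.1 + m + 2 < th'.2 := by omega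
  -- same vertex `h`; if the times differ, the earlier new vertex is a candidate for the later `prevInc`
  suffices th.1 = th'.1 from Prod.ext this hh
  by_contra hne
  rcases Nat.lt_or_gt_of_ne hne with hlt | hlt
  · -- `T < T'`: `prevInc T h < T ≤ prevInc T' h`
    obtain ⟨-, hpT, -, -⟩ := prevInc_spec γ (T := th.1 + m + 2) (by omega : i < th.1 + m + 2) (by omega) hadji
    have hcand := (prevInc_spec γ (T := th'.1 + m + 2) (h := th'.2) (i := th.1 + m + 2) (by omega)
      (by omega) (by rw [← hh]; exact hadjT.symm)).1
    omega
  · obtain ⟨-, hpT, -, -⟩ := prevInc_spec γ (T := th'.1 + m + 2) (by omega : i' < th'.1 + m + 2) (by omega) hadji'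
    have hcand := (prevInc_spec γ (T := th.1 + m + 2) (h := th.2) (i := th'.1 + m + 2) (by omega)
      (by omega) (by rw [hh]; exact hadjT'.symm)).1
    omega

/-- Two events BEFORE their windows book to different chords. [folklore] -/
theorem book_inj_before {N : ℕ} {γ : Fin N → Fin d × Bool} {th th' : ℕ × ℕ} (hb : th.2 < th.1) (hb' : th'.2 < th'.1)
    (heq : book m γ th = book m γ th') : th = th' := by
  rw [book, if_pos hb, book, if_pos hb'] at heq
  obtain ⟨h1, h2⟩ := Prod.mk.inj heq
  exact Prod.ext (by omega) h1

/-- **Fibres of the booking map**: at most one event of each kind per chord, and no event before its window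
on a visible chord. [folklore] -/
theorem card_fiber_book_le {k : ℕ} {γ : Fin (m + 1 + k) → Fin d × Bool} (c : ℕ × ℕ) :
    ((onEvents m γ).filter fun th => book m γ th = c).card ≤ if c ∈ invChords m γ then 2 else 1 := by
  classical
  have hsplit := Finset.card_filter_add_card_filter_not
    (s := (onEvents m γ).filter fun th => book m γ th = c) (fun th : ℕ × ℕ => th.2 < th.1)
  have hFa1 : (((onEvents m γ).filter fun th => book m γ th = c).filter
      fun th : ℕ × ℕ => ¬ th.2 < th.1).card ≤ 1 := by
    refine card_le_one.2 fun th hth th' hth' => ?_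
    obtain ⟨hth, ha⟩ := mem_filter.1 hth
    obtain ⟨hth', ha'⟩ := mem_filter.1 hth'
    obtain ⟨h1, h2⟩ := mem_filter.1 hth
    obtain ⟨h1', h2'⟩ := mem_filter.1 hth'
    exact book_inj_after h1 h1' ha ha' (h2.trans h2'.symm)
  have hFb1 : (((onEvents m γ).filter fun th => book m γ th = c).filter
      fun th : ℕ × ℕ => th.2 < th.1).card ≤ 1 := by
    refine card_le_one.2 fun th hth th' hth' => ?_
    obtain ⟨hth, hb⟩ := mem_filter.1 hth
    obtain ⟨hth', hb'⟩ := mem_filter.1 hth'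
    exact book_inj_before hb hb' ((mem_filter.1 hth).2.trans (mem_filter.1 hth').2.symm)
  by_cases hc : c ∈ invChords m γ
  · rw [if_pos hc]; omega
  · rw [if_neg hc]
    have hFb0 : (((onEvents m γ).filter fun th => book m γ th = c).filter
        fun th : ℕ × ℕ => th.2 < th.1).card = 0 := by
      rw [card_eq_zero, filter_eq_empty_iff]
      intro th hth hb
      obtain ⟨h1, h2⟩ := mem_filter.1 hth
      exact hc (h2 ▸ (book_mem h1).2 hb)
    omega

/-- **The booking inequality**: `#on-path events ≤ #visible chords + 2 · #invisible chords`. [folklore] -/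
theorem card_onEvents_le {k : ℕ} (γ : Fin (m + 1 + k) → Fin d × Bool) :
    (onEvents m γ).card ≤ (visChords m γ).card + 2 * (invChords m γ).card := by
  classical
  have hmaps : ∀ th ∈ onEvents m γ, book m γ th ∈ visChords m γ ∪ invChords m γ := fun th h => (book_mem h).1
  rw [card_eq_sum_card_fiberwise hmaps]
  have hdisj : Disjoint (visChords m γ) (invChords m γ) := by
    rw [disjoint_left]
    intro ij h1 h2
    have a := (mem_filter.1 h1).2
    have b := (mem_filter.1 h2).2
    omega
  rw [sum_union hdisj]
  have h1 : ∑ c ∈ visChords m γ, ((onEvents m γ).filter fun th => book m γ th = c).card ≤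
      ∑ _c ∈ visChords m γ, 1 := by
    refine sum_le_sum fun c hc => (card_fiber_book_le c).trans ?_
    rw [if_neg (disjoint_left.1 hdisj hc)]
  have h2 : ∑ c ∈ invChords m γ, ((onEvents m γ).filter fun th => book m γ th = c).card ≤
      ∑ _c ∈ invChords m γ, 2 := by
    refine sum_le_sum fun c hc => (card_fiber_book_le c).trans ?_
    rw [if_pos hc]
  rw [sum_const, smul_eq_mul, mul_one] at h1
  rw [sum_const, smul_eq_mul] at h2
  omega

/-! ### The visible chords are the window chords -/

variable (a₀ : Fin d × Bool)

/-- The genuine window chord count at time `t` is the number of visible chords with larger endpoint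
`t + m + 2`. [folklore] -/
theorem winChordTrue_eq_card {k : ℕ} (γ : Fin (m + 1 + k) → Fin d × Bool) {t : ℕ} (ht : t < k) :
    winChordTrue (winAt (m := m + 1) a₀ γ t) (wordAt a₀ γ (t + (m + 1))) =
      ((visChords m γ).filter fun ij => ij.2 = t + m + 2).card := by
  classical
  have htm : t + (m + 1) < m + 1 + k := by omega
  unfold winChordTrue
  refine card_nbij (fun j => (t + j, t + m + 2)) (fun j hj => ?_) (fun j₁ _ j₂ _ h => by
    have := (Prod.mk.inj h).1; omega) (fun ij hij => ?_)
  · rw [mem_coe, mem_filter, mem_range] at hj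
    obtain ⟨hjm, hadj⟩ := hj
    rw [wordPos_wext_winAt a₀ γ htm (by omega), wordPos_wext_winAt a₀ γ htm le_rfl,
      Literature.Probability.RandomPlanarGeometry.SAW.Zd.zdGraph_adj_sub_right,
      show t + (m + 1 + 1) = t + m + 2 by ring] at hadj
    rw [mem_coe, mem_filter, visChords, mem_filter, mem_chordPairs]
    exact ⟨⟨⟨by simp only; omega, by simp only; omega, hadj⟩, by simp only; omega, by simp only; omega⟩, rfl⟩
  · rw [mem_coe, mem_filter, visChords, mem_filter, mem_chordPairs] at hij
    obtain ⟨⟨⟨h1, h2, hadj⟩, h3, h4⟩, h5⟩ := hij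
    refine ⟨ij.1 - t, ?_, ?_⟩
    · rw [mem_coe, mem_filter, mem_range]
      refine ⟨by omega, ?_⟩
      rw [wordPos_wext_winAt a₀ γ htm (by omega), wordPos_wext_winAt a₀ γ htm le_rfl,
        Literature.Probability.RandomPlanarGeometry.SAW.Zd.zdGraph_adj_sub_right,
        show t + (ij.1 - t) = ij.1 by omega, show t + (m + 1 + 1) = ij.2 by omega]
      exact hadj
    · exact Prod.ext (by simp only; omega) (by simp only; omega)

/-- **The window chord counts add up to the number of visible chords.** [folklore] -/
theorem sum_winChordTrue_eq {k : ℕ} (γ : Fin (m + 1 + k) → Fin d × Bool) :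
    ∑ t ∈ range k, winChordTrue (winAt (m := m + 1) a₀ γ t) (wordAt a₀ γ (t + (m + 1))) =
      (visChords m γ).card := by
  classical
  rw [card_eq_sum_card_fiberwise (f := fun ij : ℕ × ℕ => ij.2 - (m + 2)) (t := range k) (fun ij hij => ?_)]
  · refine sum_congr rfl fun t ht => ?_
    rw [winChordTrue_eq_card a₀ γ (mem_range.1 ht)]
    congr 1
    ext ij
    simp only [mem_filter, and_congr_right_iff]
    intro hij
    have := (mem_filter.1 hij).2
    omega
  · have h1 := (mem_filter.1 hij).2
    have h2 := (mem_chordPairs.1 (mem_filter.1 hij).1).2.1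
    rw [mem_coe, mem_range]
    show ij.2 - (m + 2) < k
    omega

end Summit.CriticalPhenomena.PercolationContinuityZ3.Theorems.Pcint
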